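import Literature.NumberTheory.GaloisRepresentations.LubinTateComparisonUnramified
import Literature.NumberTheory.PAdicHodge.UnramifiedCompletionEmbedding
import HarnessLib

/-!
# Points of the Lubin–Tate comparison: `ϑ` on `𝔪_ℂ ⊂ 𝒪_{ℂ_F}`

Topic `NumberTheory/GaloisRepresentations`; namespace `Literature.NumberTheory.GaloisRepresentations`.

Lubin–Tate's comparison series `ϑ ∈ 𝒪̂_{F^nr}⟦X⟧` between the formal groups of `f = πX + X^q` and
`f' = π'X + X^q`, `π' = uπ` (`ltComparison`, file `LubinTateComparisonUnramified.lean`), is here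
EVALUATED on the points of the open unit ball `𝔪_ℂ` of `ℂ_F = \widehat{F̄}` (tree
`CompletedAlgClosure F`), as in the proof of Lubin–Tate 1965 Thm. 3 (p. 386) /
Cassels–Fröhlich VI §3.7: this is the analytic layer of the explicit reciprocity law
(`LubinTateReciprocity.lean`).

## Contents (all proved, no named facts)

* `UnrCoeff F` — `𝒪̂_{F^nr}` as a DISCRETE coefficient ring (cf. `LTCoeff`), acting on the closed
  unit ball `CBall F = 𝒪_{ℂ_F}` through the tree's `maxUnramifiedCompletion.toC`; `maxNilIdealC F`,
  the open unit ball as a `LubinTate.NilIdeal` (so the accepted `evalPt₁` machinery applies);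
  `instNontriviallyNormedFieldC` (the norm of `ℂ_F` is nontrivial).
* `galCBall σ`, `unrGal σ` — the action of `Γ_F` on `𝒪_{ℂ_F}` and on the coefficients, and the
  **Galois semilinearity of evaluation** `galCBall_evalPt₁ : σ(g(x)) = g^σ(σx)` (continuity of `σ`,
  `σ ∘ ι = ι ∘ σ`).
* `evalPt₁_injective` — `x ↦ P(x)` is injective on `𝔪_ℂ` when `P ≡ εX (mod deg 2)`, `ε` a unit
  (Mathlib `PowerSeries.substInvOfIsUnit`).
* Bridge `unitBallToCBall E : 𝒪_E → 𝒪_{ℂ_F}` for finite `E ⊆ F̄` (an isometry for the spectral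
  norm) and `unitBallToCBall_evalPt₁`: evaluation of `𝒪_F`-series commutes with it.
* `compSeriesC`, `homC`, `homC'` — `ϑ`, `[a]_f`, `[a]_{f'}` over `UnrCoeff F`;
  `evalPt₁_compSeriesC_homC : ϑ([a]_f x) = [a]_{f'}(ϑ x)` (Lubin–Tate (18));
  `coe_ltPolyIter_eq_hom : f^{(n)} = [π^n]_f`; `coe_evalPt₁_homC_pow : [π^n]_f x = f^{(n)}(x)`;
  `exists_algClosureToC_eq_of_aeval_eq_zero` — every `f^{(n+1)}`-division point of `ℂ_F` lies in
  `K_π^{n+1} ⊂ F̄` (root count, tree `card_roots_ltPolyIter`);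
  `map_unrGal_compSeriesC : ϑ^φ = ϑ ∘ [u]_f` ((16) over the discrete copy) and
  `evalPt₁_map_unrGal_inv_compSeriesC : ϑ^{φ⁻¹}([u]_f z) = ϑ(z)`.

## References

* [LubinTate1965] J. Lubin, J. Tate, *Formal complex multiplication in local fields*, Ann. of
  Math. 81 (1965), Thm. 3 and its proof, pp. 385–386.
* [CasselsFrohlichANT1967] J.-P. Serre, *Local class field theory*, Ch. VI of Cassels–Fröhlich,
  §3.6 Prop. 6, §3.7 Lemmas 1–2 and Thm. 3.
* [SerreLocalFields1979] J.-P. Serre, *Local Fields*, Ch. II §2 Cor. 3 (uniqueness of the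
  extension of the absolute value).
-/

noncomputable section

open MvPowerSeries

namespace Literature.NumberTheory.GaloisRepresentations

/-! ### Points: evaluating `ϑ` on `𝔪_ℂ ⊂ 𝒪_{ℂ_F}` -/

section Points

open ValuativeRel IsLocalRing Field IsNonarchimedeanLocalField LubinTate
open Literature.NumberTheory.PAdicHodge

variable (F : Type) [Field F] [ValuativeRel F] [TopologicalSpace F] [IsNonarchimedeanLocalField F]

/-- `𝒪̂_{F^nr}` as a *discrete* coefficient ring for power-series evaluation (cf. `LTCoeff`).
[folklore] -/
def UnrCoeff : Type := maxUnramifiedCompletion F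

/-- Ring structure on the discrete copy. [folklore] -/
instance : CommRing (UnrCoeff F) := inferInstanceAs (CommRing (maxUnramifiedCompletion F))
/-- Discrete uniformity on the coefficient ring. [folklore] -/
instance : UniformSpace (UnrCoeff F) := ⊥
/-- The coefficient ring is discretely uniformised. [folklore] -/
instance : DiscreteUniformity (UnrCoeff F) := ⟨rfl⟩

/-- The identification `UnrCoeff F = 𝒪̂_{F^nr}`. [folklore] -/
def UnrCoeff.of : maxUnramifiedCompletion F ≃+* UnrCoeff F := RingEquiv.refl _

/-- `𝒪[F] → 𝒪̂_{F^nr}` into the discrete copy. [folklore] -/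
def intToUnrCoeff : 𝒪[F] →+* UnrCoeff F :=
  (UnrCoeff.of F).toRingHom.comp (algebraMap 𝒪[F] (maxUnramifiedCompletion F))

/-- `ℂ_F` is a NONTRIVIALLY normed field: a uniformiser of `F` has norm in `(0, 1)`, its inverse
norm `> 1` (the tree registers only `NormedField`). [folklore] -/
instance instNontriviallyNormedFieldC : NontriviallyNormedField (CompletedAlgClosure F) :=
  { (inferInstance : NormedField (CompletedAlgClosure F)) with
    non_trivial := by
      letI := nontriviallyNormedField F
      obtain ⟨ϖ, hϖ⟩ := IsDiscreteValuationRing.exists_irreducible 𝒪[F]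
      have hϖm : ϖ ∈ 𝓂[F] := (IsLocalRing.mem_maximalIdeal _).mpr hϖ.not_isUnit
      have hv : valuation F (ϖ : F) < 1 := (mem_maximalIdeal_iff_valuation_lt_one _).mp hϖm
      have h0 : (ϖ : F) ≠ 0 := fun h => hϖ.ne_zero (Subtype.ext h)
      refine ⟨algebraMap F (CompletedAlgClosure F) (ϖ : F)⁻¹, ?_⟩
      rw [CompletedAlgClosure.norm_algebraMap, norm_inv, one_lt_inv_iff₀]
      exact ⟨norm_pos_iff.mpr h0, (norm_lt_one_iff F _).mpr hv⟩ }

/-- The evaluation target: the closed unit ball `𝒪_{ℂ_F}` of `ℂ_F` (tree `unitBall`). [folklore] -/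
abbrev CBall : Subring (CompletedAlgClosure F) := unitBall (CompletedAlgClosure F)

/-- `𝒪̂_{F^nr} → 𝒪_{ℂ_F}` (the canonical embedding `toC`, of norm `≤ 1`), on the discrete copy.
[cite: SerreLocalFields1979, Ch. II §5] -/
def coeffToCBall : UnrCoeff F →+* CBall F where
  toFun x := ⟨maxUnramifiedCompletion.toC F ((UnrCoeff.of F).symm x),
    (mem_unitBall_iff _).mpr (norm_toC_le_one _)⟩
  map_one' := by ext; simp
  map_mul' x y := by ext; simp
  map_zero' := by ext; simp
  map_add' x y := by ext; simp

/-- `𝒪_{ℂ_F}` as an algebra over the discrete coefficient ring. [folklore] -/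
instance algUnrCoeff : Algebra (UnrCoeff F) (CBall F) := (coeffToCBall F).toAlgebra

/-- The discrete coefficient ring acts continuously. [folklore] -/
instance contSMulUnrCoeff : ContinuousSMul (UnrCoeff F) (CBall F) := by
  refine ⟨continuous_prod_of_discrete_left.mpr fun a => ?_⟩
  change Continuous fun s : CBall F => (coeffToCBall F a) * s
  exact continuous_const_mul _

/-- Unfolding the algebra map. [folklore] -/
theorem algebraMap_unrCoeff_coe (x : UnrCoeff F) :
    ((algebraMap (UnrCoeff F) (CBall F) x : CBall F) : CompletedAlgClosure F) =
      maxUnramifiedCompletion.toC F ((UnrCoeff.of F).symm x) := rfl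

/-- The maximal ideal `𝔪_ℂ = {‖x‖ < 1}` of `𝒪_{ℂ_F}` as a closed nil ideal: the domain of the
points. [cite: CasselsFrohlichANT1967, Ch. VI §3.2] -/
def maxNilIdealC : NilIdeal (CBall F) where
  toIdeal := ballIdeal (CompletedAlgClosure F) one_pos
  isClosed := isClosed_ballIdeal_one _
  isTopologicallyNilpotent _ hx := isTopologicallyNilpotent_of_norm_lt_one _ hx

variable {F}

/-- **`σ ∈ Γ_F` acting on `𝒪_{ℂ_F}`** (restriction of the isometric action on `ℂ_F`). [folklore] -/
def galCBall (σ : absoluteGaloisGroup F) : CBall F →+* CBall F :=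
  (CompletedAlgClosure.galRingHom σ).restrict (CBall F) (CBall F) fun x hx => by
    refine (mem_unitBall_iff _).mpr ?_
    change ‖σ • (x : CompletedAlgClosure F)‖ ≤ 1
    rw [CompletedAlgClosure.norm_smul]
    exact (mem_unitBall_iff _).mp hx

/-- Unfolding: `galCBall σ x = σ • x`. [folklore] -/
@[simp] theorem coe_galCBall (σ : absoluteGaloisGroup F) (x : CBall F) :
    ((galCBall σ x : CBall F) : CompletedAlgClosure F) = σ • (x : CompletedAlgClosure F) := rfl

/-- `galCBall σ` is continuous. [folklore] -/
theorem continuous_galCBall (σ : absoluteGaloisGroup F) : Continuous (galCBall (F := F) σ) := by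
  refine Continuous.subtype_mk ?_ _
  exact (CompletedAlgClosure.continuous_galRingHom σ).comp continuous_subtype_val

/-- `galCBall σ` preserves `𝔪_ℂ`. [folklore] -/
theorem galCBall_mem {σ : absoluteGaloisGroup F} {x : CBall F} (hx : x ∈ (maxNilIdealC F).toIdeal) :
    galCBall σ x ∈ (maxNilIdealC F).toIdeal := by
  change ‖((galCBall σ x : CBall F) : CompletedAlgClosure F)‖ < 1
  rw [coe_galCBall, CompletedAlgClosure.norm_smul]
  exact hx

/-- The Galois action on the discrete coefficient ring (transport of `galAut`). [folklore] -/
def unrGal (σ : absoluteGaloisGroup F) : UnrCoeff F →+* UnrCoeff F :=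
  ((UnrCoeff.of F).toRingHom.comp (maxUnramifiedCompletion.galAut F σ).toRingHom).comp
    (UnrCoeff.of F).symm.toRingHom

/-- **Compatibility**: `σ • ι(c) = ι(σ c)` on the coefficient ring (tree `smul_toC`). [folklore] -/
theorem galCBall_algebraMap (σ : absoluteGaloisGroup F) (c : UnrCoeff F) :
    galCBall σ (algebraMap (UnrCoeff F) (CBall F) c) = algebraMap (UnrCoeff F) (CBall F) (unrGal σ c) := by
  apply Subtype.ext
  rw [coe_galCBall, algebraMap_unrCoeff_coe, algebraMap_unrCoeff_coe, smul_toC]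
  rfl

/-- **Galois semilinearity of evaluation**: `σ(g(x)) = g^σ(σ x)` for a constant-term-free
`g ∈ 𝒪̂_{F^nr}⟦X⟧` and `x ∈ 𝔪_ℂ` (continuity of `σ` on `ℂ_F` and `σ ∘ ι = ι ∘ σ`).
[cite: LubinTate1965, proof of Thm. 3, p. 386] -/
theorem galCBall_evalPt₁ (σ : absoluteGaloisGroup F) (g : PowerSeries (UnrCoeff F))
    (hg : PowerSeries.constantCoeff g = 0) (x : (maxNilIdealC F).toIdeal) :
    galCBall σ (evalPt₁ (maxNilIdealC F) g hg x : CBall F) =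
      evalPt₁ (maxNilIdealC F) (g.map (unrGal σ)) (by
        rw [← PowerSeries.coeff_zero_eq_constantCoeff_apply, PowerSeries.coeff_map,
          PowerSeries.coeff_zero_eq_constantCoeff_apply, hg, map_zero])
        ⟨galCBall σ x, galCBall_mem x.2⟩ := by
  rw [coe_evalPt₁, coe_evalPt₁, PowerSeries.aeval, PowerSeries.aeval]
  have h1 := MvPowerSeries.hasSum_aeval ((maxNilIdealC F).hasEval fun _ : Unit => x) (g : MvPowerSeries Unit (UnrCoeff F))
  have h2 := MvPowerSeries.hasSum_aeval
    ((maxNilIdealC F).hasEval fun _ : Unit => (⟨galCBall σ x, galCBall_mem x.2⟩ : (maxNilIdealC F).toIdeal))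
    (MvPowerSeries.map (unrGal σ) g : MvPowerSeries Unit (UnrCoeff F))
  have h1' := h1.map (galCBall σ) (continuous_galCBall σ)
  have hfun : (⇑(galCBall σ) ∘ fun d : Unit →₀ ℕ =>
      (MvPowerSeries.coeff d) g • d.prod fun s e => ((x : CBall F) : CBall F) ^ e) =
      fun d => (MvPowerSeries.coeff d) (MvPowerSeries.map (unrGal σ) g) •
        d.prod fun s e => (((⟨galCBall σ x, galCBall_mem x.2⟩ : (maxNilIdealC F).toIdeal) : CBall F)) ^ e := by
    funext d
    simp only [Function.comp_apply, MvPowerSeries.coeff_map]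
    rw [Algebra.smul_def, Algebra.smul_def, map_mul, galCBall_algebraMap, Finsupp.prod, Finsupp.prod,
      map_prod]
    simp only [map_pow]
  rw [hfun] at h1'
  exact h1'.unique h2

/-- Evaluating a constant-term-free series at `0` gives `0`. [folklore] -/
theorem evalPt₁_zero (g : PowerSeries (UnrCoeff F)) (hg : PowerSeries.constantCoeff g = 0) :
    evalPt₁ (maxNilIdealC F) g hg 0 = 0 := by
  classical
  apply Subtype.ext
  rw [coe_evalPt₁, PowerSeries.aeval, MvPowerSeries.aeval_eq_sum]
  change (∑' d : Unit →₀ ℕ, MvPowerSeries.coeff d g •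
    d.prod (fun s e => ((0 : (maxNilIdealC F).toIdeal) : CBall F) ^ e)) = (0 : CBall F)
  refine (tsum_congr fun d => ?_).trans tsum_zero
  by_cases hd : d = 0
  · subst hd
    rw [MvPowerSeries.coeff_zero_eq_constantCoeff_apply]
    change PowerSeries.constantCoeff g • _ = (0 : CBall F)
    rw [hg, zero_smul]
  · obtain ⟨i, hi⟩ := Finsupp.ne_iff.mp hd
    rw [Finsupp.prod, ← Finset.prod_erase_mul _ _ (Finsupp.mem_support_iff.mpr hi)]
    simp [zero_pow hi]

/-- A constant-term-free series with invertible linear coefficient is injective on points: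
`Λ(P(x)) = x` for Mathlib's left inverse `Λ = substInvOfIsUnit P` (`Λ ∘ P = X`). [folklore] -/
theorem evalPt₁_substInvOfIsUnit_evalPt₁ (P : PowerSeries (UnrCoeff F))
    (hP : PowerSeries.constantCoeff P = 0) (hP' : IsUnit (PowerSeries.coeff 1 P))
    (x : (maxNilIdealC F).toIdeal) :
    evalPt₁ (maxNilIdealC F) (P.substInvOfIsUnit hP') (PowerSeries.constantCoeff_substInvOfIsUnit P hP')
      (evalPt₁ (maxNilIdealC F) P hP x) = x := by
  have h := PowerSeries.subst_substInvOfIsUnit_left P hP hP'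
  have hX : (PowerSeries.subst P (P.substInvOfIsUnit hP')).constantCoeff = 0 := by
    rw [h]; exact MvPowerSeries.constantCoeff_X ()
  have hXeq : PowerSeries.subst P (P.substInvOfIsUnit hP') =
      (MvPowerSeries.X () : MvPowerSeries Unit (UnrCoeff F)) := h
  have h1 := evalPt₁_subst (maxNilIdealC F) (τ := Unit) (P : MvPowerSeries Unit (UnrCoeff F)) hP
    (P.substInvOfIsUnit hP') (PowerSeries.constantCoeff_substInvOfIsUnit P hP') hX (fun _ => x)
  rw [evalPt_congr (maxNilIdealC F) hXeq hX (MvPowerSeries.constantCoeff_X ()), evalPt_X] at h1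
  exact h1.symm

/-- Injectivity of `x ↦ P(x)` on `𝔪_ℂ` for `P ≡ uX (mod deg 2)`, `u` a unit. [folklore] -/
theorem evalPt₁_injective (P : PowerSeries (UnrCoeff F)) (hP : PowerSeries.constantCoeff P = 0)
    (hP' : IsUnit (PowerSeries.coeff 1 P)) :
    Function.Injective (evalPt₁ (maxNilIdealC F) P hP) := fun x y hxy => by
  rw [← evalPt₁_substInvOfIsUnit_evalPt₁ P hP hP' x, ← evalPt₁_substInvOfIsUnit_evalPt₁ P hP hP' y, hxy]

section Bridge

-- the normed-field instances on `F` and on finite subextensions of `F̄` of `LubinTateTorsion.lean`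
attribute [local instance] instUniformSpace_literature rk1 nF nE

/-- (local) the uniform structure of `F` is a group uniformity. [folklore] -/
local instance bridgeIsUniformAddGroup : IsUniformAddGroup F := isUniformAddGroup_of_addCommGroup

variable (E : IntermediateField F (AlgebraicClosure F)) [FiniteDimensional F E]

/-- `F̄ → ℂ_F` is isometric on a finite subextension `E` for its spectral norm (the spectral norm
only depends on the minimal polynomial). [cite: SerreLocalFields1979, Ch. II §2 Cor. 3] -/
theorem norm_algClosureToC_coe (x : E) : ‖algClosureToC F (x : AlgebraicClosure F)‖ = ‖x‖ := by
  rw [norm_algClosureToC, algNorm_def, norm_eq_spectralNorm,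
    spectralNorm.eq_of_tower (K := F) (E := E) (L := AlgebraicClosure F) x]
  rfl

/-- **`𝒪_E → 𝒪_{ℂ_F}`** along `E ⊆ F̄ ⊆ ℂ_F`. [folklore] -/
def unitBallToCBall : unitBall E →+* CBall F where
  toFun x := ⟨algClosureToC F ((x : E) : AlgebraicClosure F), (mem_unitBall_iff _).mpr (by
    rw [norm_algClosureToC_coe]; exact (mem_unitBall_iff E).mp x.2)⟩
  map_one' := by ext; simp
  map_mul' x y := by ext; simp
  map_zero' := by ext; simp
  map_add' x y := by ext; simp

/-- Unfolding. [folklore] -/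
@[simp] theorem coe_unitBallToCBall (x : unitBall E) :
    ((unitBallToCBall E x : CBall F) : CompletedAlgClosure F) = algClosureToC F ((x : E) : AlgebraicClosure F) := rfl

/-- `𝒪_E → 𝒪_{ℂ_F}` is continuous (an isometry). [folklore] -/
theorem continuous_unitBallToCBall : Continuous (unitBallToCBall (F := F) E) := by
  refine (AddMonoidHomClass.isometry_of_norm (unitBallToCBall (F := F) E) fun x => ?_).continuous
  change ‖algClosureToC F ((x : E) : AlgebraicClosure F)‖ = ‖(x : E)‖
  exact norm_algClosureToC_coe E x

/-- `𝒪_E → 𝒪_{ℂ_F}` maps `𝔪_E` into `𝔪_ℂ`. [folklore] -/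
theorem unitBallToCBall_mem {x : unitBall E} (hx : x ∈ (maxNilIdeal F E).toIdeal) :
    unitBallToCBall E x ∈ (maxNilIdealC F).toIdeal := by
  change ‖((unitBallToCBall E x : CBall F) : CompletedAlgClosure F)‖ < 1
  rw [coe_unitBallToCBall, norm_algClosureToC_coe]
  exact hx

/-- Compatibility of the coefficient maps: both send `c ∈ 𝒪_F` to `c ∈ ℂ_F`. [folklore] -/
theorem unitBallToCBall_algebraMap (c : LTCoeff F) :
    unitBallToCBall E (algebraMap (LTCoeff F) (unitBall E) c) =
      algebraMap (UnrCoeff F) (CBall F) (intToUnrCoeff F ((LTCoeff.of F).symm c)) := by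
  apply Subtype.ext
  rw [coe_unitBallToCBall, algebraMap_unrCoeff_coe, intToUnrCoeff, RingHom.comp_apply,
    RingEquiv.toRingHom_eq_coe, RingHom.coe_coe, RingEquiv.symm_apply_apply, toC_algebraMap]
  change algClosureToC F (algebraMap F (AlgebraicClosure F) (((LTCoeff.of F).symm c : 𝒪[F]) : F)) = _
  exact algClosureToC_algebraMap _

/-- **Evaluation commutes with `𝒪_E → 𝒪_{ℂ_F}`**: for a constant-term-free `g ∈ 𝒪_F⟦X⟧` and
`x ∈ 𝔪_E`, `g(x)` computed in `𝒪_E` (coefficients `LTCoeff F`) maps to `g(x)` computed in `𝒪_{ℂ_F}`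
(coefficients `𝒪̂_{F^nr}`). [folklore] -/
theorem unitBallToCBall_evalPt₁ (g : PowerSeries 𝒪[F]) (hg : PowerSeries.constantCoeff g = 0)
    (x : (maxNilIdeal F E).toIdeal) :
    unitBallToCBall E (evalPt₁ (maxNilIdeal F E) (PowerSeries.map (LTCoeff.of F).toRingHom g) (by
        rw [← PowerSeries.coeff_zero_eq_constantCoeff_apply, PowerSeries.coeff_map,
          PowerSeries.coeff_zero_eq_constantCoeff_apply, hg, map_zero]) x : unitBall E) =
      evalPt₁ (maxNilIdealC F) (PowerSeries.map (intToUnrCoeff F) g) (by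
        rw [← PowerSeries.coeff_zero_eq_constantCoeff_apply, PowerSeries.coeff_map,
          PowerSeries.coeff_zero_eq_constantCoeff_apply, hg, map_zero])
        ⟨unitBallToCBall E x, unitBallToCBall_mem E x.2⟩ := by
  rw [coe_evalPt₁, coe_evalPt₁, PowerSeries.aeval, PowerSeries.aeval]
  have h1 := MvPowerSeries.hasSum_aeval ((maxNilIdeal F E).hasEval fun _ : Unit => x)
    (PowerSeries.map (LTCoeff.of F).toRingHom g : MvPowerSeries Unit (LTCoeff F))
  have h2 := MvPowerSeries.hasSum_aeval
    ((maxNilIdealC F).hasEval fun _ : Unit => (⟨unitBallToCBall E x, unitBallToCBall_mem E x.2⟩ : (maxNilIdealC F).toIdeal))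
    (PowerSeries.map (intToUnrCoeff F) g : MvPowerSeries Unit (UnrCoeff F))
  have h1' := h1.map (unitBallToCBall E) (continuous_unitBallToCBall E)
  have hfun : (⇑(unitBallToCBall E) ∘ fun d : Unit →₀ ℕ =>
      (MvPowerSeries.coeff d) (PowerSeries.map (LTCoeff.of F).toRingHom g : MvPowerSeries Unit (LTCoeff F)) •
        d.prod fun s e => ((x : unitBall E) : unitBall E) ^ e) =
      fun d => (MvPowerSeries.coeff d) (PowerSeries.map (intToUnrCoeff F) g : MvPowerSeries Unit (UnrCoeff F)) •
        d.prod fun s e => (((⟨unitBallToCBall E x, unitBallToCBall_mem E x.2⟩ : (maxNilIdealC F).toIdeal) : CBall F)) ^ e := by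
    funext d
    simp only [Function.comp_apply]
    rw [Algebra.smul_def, Algebra.smul_def, map_mul, unitBallToCBall_algebraMap, Finsupp.prod, Finsupp.prod,
      map_prod]
    simp only [map_pow]
    congr 2
  rw [hfun] at h1'
  exact h1'.unique h2

end Bridge

section ComparisonPoints

variable {π : 𝒪[F]} (hπ : (valuation F).IsUniformizer (π : F))
  {σ₀ : absoluteGaloisGroup F} (hσ₀ : IsAbsArithFrob σ₀) (u : 𝒪[F]ˣ)
  {ε : (maxUnramifiedCompletion F)ˣ}
  (hε : maxUnramifiedCompletion.galAut F σ₀ (ε : maxUnramifiedCompletion F) =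
    algebraMap 𝒪[F] (maxUnramifiedCompletion F) (u : 𝒪[F]) * (ε : maxUnramifiedCompletion F))

/-- `ϑ` with coefficients in the discrete copy. [cite: LubinTate1965, Lemma p. 385] -/
def compSeriesC : PowerSeries (UnrCoeff F) :=
  PowerSeries.map (UnrCoeff.of F).toRingHom (ltComparison hπ hσ₀ u hε)

/-- `ϑ` has no constant term. [cite: LubinTate1965, Lemma p. 385] -/
theorem constantCoeff_compSeriesC : PowerSeries.constantCoeff (compSeriesC hπ hσ₀ u hε) = 0 := by
  rw [compSeriesC, ← PowerSeries.coeff_zero_eq_constantCoeff_apply, PowerSeries.coeff_map,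
    PowerSeries.coeff_zero_eq_constantCoeff_apply, constantCoeff_ltComparison, map_zero]

/-- The linear coefficient `ε` of `ϑ` is a unit. [cite: LubinTate1965, Lemma p. 385] -/
theorem isUnit_coeff_one_compSeriesC : IsUnit (PowerSeries.coeff 1 (compSeriesC hπ hσ₀ u hε)) := by
  rw [compSeriesC, PowerSeries.coeff_map, coeff_one_ltComparison]
  exact ε.isUnit.map _

/-- `[a]_f` over the discrete copy of `𝒪̂_{F^nr}`. [folklore] -/
def homC (a : 𝒪[F]) : PowerSeries (UnrCoeff F) :=
  PowerSeries.map (intToUnrCoeff F) (hom (isLTRing_integer F hπ) (isLTSeries_ltPoly F) (isLTSeries_ltPoly F) a)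

/-- `[a]_{f'}` over the discrete copy (`f' = (uπ)X + X^q`). [folklore] -/
def homC' (a : 𝒪[F]) : PowerSeries (UnrCoeff F) :=
  PowerSeries.map (intToUnrCoeff F) (hom (isLTRing_unit_mul hπ u) (isLTSeries_ltPoly F (π := (u : 𝒪[F]) * π))
    (isLTSeries_ltPoly F (π := (u : 𝒪[F]) * π)) a)

omit [TopologicalSpace F] [IsNonarchimedeanLocalField F] in
/-- Mapped `[a]`-series have no constant term. [folklore] -/
theorem constantCoeff_map_hom {R : Type*} [CommRing R] (h : 𝒪[F] →+* R) {π' : 𝒪[F]} {q : ℕ}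
    (hA : IsLTRing π' q) {g : PowerSeries 𝒪[F]} (hg : IsLTSeries π' q g) (a : 𝒪[F]) :
    PowerSeries.constantCoeff (PowerSeries.map h (hom hA hg hg a)) = 0 := by
  rw [← PowerSeries.coeff_zero_eq_constantCoeff_apply, PowerSeries.coeff_map,
    PowerSeries.coeff_zero_eq_constantCoeff_apply, constantCoeff_hom, map_zero]

/-- `[a]_f` has no constant term (discrete copy). [folklore] -/
theorem constantCoeff_homC (a : 𝒪[F]) : PowerSeries.constantCoeff (homC hπ a) = 0 :=
  constantCoeff_map_hom _ _ _ a

/-- `[a]_{f'}` has no constant term (discrete copy). [folklore] -/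
theorem constantCoeff_homC' (a : 𝒪[F]) : PowerSeries.constantCoeff (homC' hπ u a) = 0 :=
  constantCoeff_map_hom _ _ _ a

/-- **`ϑ([a]_f x) = [a]_{f'}(ϑ x)`** on `𝔪_ℂ` (evaluation of `ϑ ∘ [a]_f = [a]_{f'} ∘ ϑ`).
[cite: LubinTate1965, Lemma p. 385, (18)] -/
theorem evalPt₁_compSeriesC_homC (a : 𝒪[F]) (x : (maxNilIdealC F).toIdeal) :
    evalPt₁ (maxNilIdealC F) (compSeriesC hπ hσ₀ u hε) (constantCoeff_compSeriesC hπ hσ₀ u hε)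
        (evalPt₁ (maxNilIdealC F) (homC hπ a) (constantCoeff_homC hπ a) x) =
      evalPt₁ (maxNilIdealC F) (homC' hπ u a) (constantCoeff_homC' hπ u a)
        (evalPt₁ (maxNilIdealC F) (compSeriesC hπ hσ₀ u hε) (constantCoeff_compSeriesC hπ hσ₀ u hε) x) := by
  -- the series identity, transported to the discrete copy
  have hser : PowerSeries.subst (homC hπ a) (compSeriesC hπ hσ₀ u hε) =
      PowerSeries.subst (compSeriesC hπ hσ₀ u hε) (homC' hπ u a) := by
    have h := congrArg (PowerSeries.map (UnrCoeff.of F).toRingHom) (subst_hom_ltComparison hπ hσ₀ u hε a)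
    have hs1 : PowerSeries.HasSubst ((hom (isLTRing_integer F hπ) (isLTSeries_ltPoly F) (isLTSeries_ltPoly F) a).map
        (algebraMap 𝒪[F] (maxUnramifiedCompletion F))) :=
      PowerSeries.HasSubst.of_constantCoeff_zero' (constantCoeff_map_hom _ _ _ a)
    have hs2 : PowerSeries.HasSubst (ltComparison hπ hσ₀ u hε) :=
      PowerSeries.HasSubst.of_constantCoeff_zero' (constantCoeff_ltComparison hπ hσ₀ u hε)
    erw [PowerSeries.map_subst hs1, PowerSeries.map_subst hs2] at h
    rw [compSeriesC, homC, homC', intToUnrCoeff, PowerSeries.map_comp, RingHom.comp_apply, RingHom.comp_apply]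
    exact h
  have hc1 : (PowerSeries.subst (homC hπ a) (compSeriesC hπ hσ₀ u hε)).constantCoeff = 0 := by
    rw [PowerSeries.subst_def]
    exact MvPowerSeries.constantCoeff_subst_eq_zero
      (MvPowerSeries.hasSubst_of_constantCoeff_zero fun _ => constantCoeff_homC hπ a)
      (fun _ => constantCoeff_homC hπ a) (constantCoeff_compSeriesC hπ hσ₀ u hε)
  have hc2 : (PowerSeries.subst (compSeriesC hπ hσ₀ u hε) (homC' hπ u a)).constantCoeff = 0 := by
    rw [PowerSeries.subst_def]
    exact MvPowerSeries.constantCoeff_subst_eq_zero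
      (MvPowerSeries.hasSubst_of_constantCoeff_zero fun _ => constantCoeff_compSeriesC hπ hσ₀ u hε)
      (fun _ => constantCoeff_compSeriesC hπ hσ₀ u hε) (constantCoeff_homC' hπ u a)
  have h1 := evalPt₁_subst (maxNilIdealC F) (τ := Unit) (homC hπ a : MvPowerSeries Unit (UnrCoeff F))
    (constantCoeff_homC hπ a) (compSeriesC hπ hσ₀ u hε) (constantCoeff_compSeriesC hπ hσ₀ u hε) hc1 (fun _ => x)
  have h2 := evalPt₁_subst (maxNilIdealC F) (τ := Unit) (compSeriesC hπ hσ₀ u hε : MvPowerSeries Unit (UnrCoeff F))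
    (constantCoeff_compSeriesC hπ hσ₀ u hε) (homC' hπ u a) (constantCoeff_homC' hπ u a) hc2 (fun _ => x)
  rw [evalPt_congr (maxNilIdealC F) hser hc1 hc2] at h1
  exact (h1.symm.trans h2)

omit [IsNonarchimedeanLocalField F] in
/-- Composition of polynomials is substitution of power series (when the inner one has no constant
term). [folklore] -/
theorem coe_comp_eq_subst {R : Type*} [CommRing R] (p r : Polynomial R) (hr : r.coeff 0 = 0) :
    ((p.comp r : Polynomial R) : PowerSeries R) = PowerSeries.subst (r : PowerSeries R) (p : PowerSeries R) := by
  have hs : PowerSeries.HasSubst (r : PowerSeries R) := by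
    refine PowerSeries.HasSubst.of_constantCoeff_zero' ?_
    rw [← PowerSeries.coeff_zero_eq_constantCoeff_apply, Polynomial.coeff_coe, hr]
  induction p using Polynomial.induction_on' with
  | add p q hp hq =>
    rw [Polynomial.add_comp, Polynomial.coe_add, Polynomial.coe_add, PowerSeries.subst_add hs, hp, hq]
  | monomial n a =>
    rw [← Polynomial.C_mul_X_pow_eq_monomial, Polynomial.mul_comp, Polynomial.C_comp,
      Polynomial.X_pow_comp, Polynomial.coe_mul, Polynomial.coe_pow, Polynomial.coe_C,
      Polynomial.coe_mul, Polynomial.coe_pow, Polynomial.coe_C, Polynomial.coe_X,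
      PowerSeries.subst_mul hs, PowerSeries.subst_pow hs, PowerSeries.subst_C, PowerSeries.subst_X hs]
    rfl

omit [IsNonarchimedeanLocalField F] in
/-- The iterates commute with `f`: `f^{(n+1)} = f^{(n)} ∘ f`. [folklore] -/
theorem ltPolyIter_succ' [IsNonarchimedeanLocalField F] (π' : 𝒪[F]) (n : ℕ) :
    ltPolyIter F π' (n + 1) = (ltPolyIter F π' n).comp (ltPoly F π') := by
  induction n with
  | zero => rw [ltPolyIter_succ, ltPolyIter_zero, Polynomial.X_comp, Polynomial.comp_X]
  | succ n ih => rw [ltPolyIter_succ, ih, ← Polynomial.comp_assoc, ← ltPolyIter_succ, ih]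

/-- **`f^{(n)} = [π'^n]_f` as power series** (`f = π'X + X^q`; `[π'] = f`, `[a][b] = [ab]`).
[cite: LubinTate1965, §1 Thm. 1 (9), (11)] -/
theorem coe_ltPolyIter_eq_hom {π' : 𝒪[F]} (hπ' : (valuation F).IsUniformizer (π' : F)) (n : ℕ) :
    ((ltPolyIter F π' n : Polynomial 𝒪[F]) : PowerSeries 𝒪[F]) =
      hom (isLTRing_integer F hπ') (isLTSeries_ltPoly F) (isLTSeries_ltPoly F) (π' ^ n) := by
  induction n with
  | zero => rw [ltPolyIter_zero, Polynomial.coe_X, pow_zero, hom_one]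
  | succ n ih =>
    have hq0 : 0 ≠ residueFieldCard F := by have := one_lt_residueFieldCard F; omega
    have h0 : (ltPoly F π').coeff 0 = 0 := by simp [ltPoly, hq0]
    rw [ltPolyIter_succ', coe_comp_eq_subst _ _ h0, ih]
    have e := hom_comp_hom (isLTRing_integer F hπ') (isLTSeries_ltPoly F) (isLTSeries_ltPoly F)
      (isLTSeries_ltPoly F) (π' ^ n) π'
    rw [hom_self_eq] at e
    rw [e, pow_succ]

/-- `[π^n]_f x` is the value of the polynomial `f^{(n)}` at `x`. [folklore] -/
theorem coe_evalPt₁_homC_pow (n : ℕ) (x : (maxNilIdealC F).toIdeal) :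
    ((evalPt₁ (maxNilIdealC F) (homC hπ (π ^ n)) (constantCoeff_homC hπ _) x : CBall F) : CompletedAlgClosure F) =
      Polynomial.aeval ((x : CBall F) : CompletedAlgClosure F)
        ((ltPolyIter F π n).map (algebraMap 𝒪[F] F)) := by
  have hp : PowerSeries.constantCoeff (((ltPolyIter F π n).map (intToUnrCoeff F) : Polynomial (UnrCoeff F)) :
      PowerSeries (UnrCoeff F)) = 0 := by
    rw [← PowerSeries.coeff_zero_eq_constantCoeff_apply, Polynomial.coeff_coe, Polynomial.coeff_map,
      coeff_zero_ltPolyIter, map_zero]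
  have hser : homC hπ (π ^ n) = (((ltPolyIter F π n).map (intToUnrCoeff F) : Polynomial (UnrCoeff F)) :
      PowerSeries (UnrCoeff F)) := by
    rw [homC, ← coe_ltPolyIter_eq_hom hπ, Polynomial.polynomial_map_coe]
  have h1 : evalPt₁ (maxNilIdealC F) (homC hπ (π ^ n)) (constantCoeff_homC hπ _) x =
      evalPt₁ (maxNilIdealC F) _ hp x := evalPt_congr (maxNilIdealC F) hser _ _ _
  rw [h1, coe_evalPt₁_coe, Polynomial.aeval_def, Polynomial.eval₂_map, Polynomial.aeval_def,
    Polynomial.eval₂_map,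
    show ((Polynomial.eval₂ ((algebraMap (UnrCoeff F) (CBall F)).comp (intToUnrCoeff F)) (x : CBall F)
        (ltPolyIter F π n) : CBall F) : CompletedAlgClosure F) =
      (CBall F).subtype (Polynomial.eval₂ ((algebraMap (UnrCoeff F) (CBall F)).comp (intToUnrCoeff F))
        (x : CBall F) (ltPolyIter F π n)) from rfl,
    Polynomial.hom_eval₂]
  congr 1
  ext a
  rw [RingHom.comp_apply, RingHom.comp_apply, RingHom.comp_apply, Subring.subtype_apply,
    algebraMap_unrCoeff_coe, intToUnrCoeff, RingHom.comp_apply]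
  exact toC_algebraMap a

/-- `[ab]_{f'}(y) = [a]_{f'}([b]_{f'}(y))` on `𝔪_ℂ`. [cite: LubinTate1965, §1 Thm. 1 (9)] -/
theorem evalPt₁_homC'_mul (a b : 𝒪[F]) (y : (maxNilIdealC F).toIdeal) :
    evalPt₁ (maxNilIdealC F) (homC' hπ u (a * b)) (constantCoeff_homC' hπ u _) y =
      evalPt₁ (maxNilIdealC F) (homC' hπ u a) (constantCoeff_homC' hπ u a)
        (evalPt₁ (maxNilIdealC F) (homC' hπ u b) (constantCoeff_homC' hπ u b) y) := by
  have hser : PowerSeries.subst (homC' hπ u b) (homC' hπ u a) = homC' hπ u (a * b) := by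
    have h := congrArg (PowerSeries.map (intToUnrCoeff F))
      (hom_comp_hom (isLTRing_unit_mul hπ u) (isLTSeries_ltPoly F (π := (u : 𝒪[F]) * π))
        (isLTSeries_ltPoly F (π := (u : 𝒪[F]) * π)) (isLTSeries_ltPoly F (π := (u : 𝒪[F]) * π)) a b)
    erw [PowerSeries.map_subst (PowerSeries.HasSubst.of_constantCoeff_zero' (constantCoeff_hom _ _ _ b))] at h
    exact h
  have hc : (PowerSeries.subst (homC' hπ u b) (homC' hπ u a)).constantCoeff = 0 := by
    rw [hser]; exact constantCoeff_homC' hπ u _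
  have h1 := evalPt₁_subst (maxNilIdealC F) (τ := Unit) (homC' hπ u b : MvPowerSeries Unit (UnrCoeff F))
    (constantCoeff_homC' hπ u b) (homC' hπ u a) (constantCoeff_homC' hπ u a) hc (fun _ => y)
  rw [evalPt_congr (maxNilIdealC F) hser hc (constantCoeff_homC' hπ u _)] at h1
  exact h1

/-- `[ab]_f(y) = [a]_f([b]_f(y))` on `𝔪_ℂ`. [cite: LubinTate1965, §1 Thm. 1 (9)] -/
theorem evalPt₁_homC_mul (a b : 𝒪[F]) (y : (maxNilIdealC F).toIdeal) :
    evalPt₁ (maxNilIdealC F) (homC hπ (a * b)) (constantCoeff_homC hπ _) y =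
      evalPt₁ (maxNilIdealC F) (homC hπ a) (constantCoeff_homC hπ a)
        (evalPt₁ (maxNilIdealC F) (homC hπ b) (constantCoeff_homC hπ b) y) := by
  have hser : PowerSeries.subst (homC hπ b) (homC hπ a) = homC hπ (a * b) := by
    have h := congrArg (PowerSeries.map (intToUnrCoeff F))
      (hom_comp_hom (isLTRing_integer F hπ) (isLTSeries_ltPoly F) (isLTSeries_ltPoly F) (isLTSeries_ltPoly F) a b)
    erw [PowerSeries.map_subst (PowerSeries.HasSubst.of_constantCoeff_zero' (constantCoeff_hom _ _ _ b))] at h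
    exact h
  have hc : (PowerSeries.subst (homC hπ b) (homC hπ a)).constantCoeff = 0 := by
    rw [hser]; exact constantCoeff_homC hπ _
  have h1 := evalPt₁_subst (maxNilIdealC F) (τ := Unit) (homC hπ b : MvPowerSeries Unit (UnrCoeff F))
    (constantCoeff_homC hπ b) (homC hπ a) (constantCoeff_homC hπ a) hc (fun _ => y)
  rw [evalPt_congr (maxNilIdealC F) hser hc (constantCoeff_homC hπ _)] at h1
  exact h1

/-- `[1]_f(y) = y` on `𝔪_ℂ`. [cite: LubinTate1965, §1 Thm. 1 (11)] -/
theorem evalPt₁_homC_one (y : (maxNilIdealC F).toIdeal) :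
    evalPt₁ (maxNilIdealC F) (homC hπ 1) (constantCoeff_homC hπ 1) y = y := by
  have hser : homC hπ 1 = (MvPowerSeries.X () : MvPowerSeries Unit (UnrCoeff F)) := by
    rw [homC, hom_one]; exact MvPowerSeries.map_X _ ()
  unfold evalPt₁
  rw [evalPt_congr (maxNilIdealC F) hser (constantCoeff_homC hπ 1) (MvPowerSeries.constantCoeff_X ()), evalPt_X]

/-- `[1]_{f'}(y) = y` on `𝔪_ℂ`. [cite: LubinTate1965, §1 Thm. 1 (11)] -/
theorem evalPt₁_homC'_one (y : (maxNilIdealC F).toIdeal) :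
    evalPt₁ (maxNilIdealC F) (homC' hπ u 1) (constantCoeff_homC' hπ u 1) y = y := by
  have hser : homC' hπ u 1 = (MvPowerSeries.X () : MvPowerSeries Unit (UnrCoeff F)) := by
    rw [homC', hom_one]; exact MvPowerSeries.map_X _ ()
  unfold evalPt₁
  rw [evalPt_congr (maxNilIdealC F) hser (constantCoeff_homC' hπ u 1) (MvPowerSeries.constantCoeff_X ()), evalPt_X]

include hπ in
/-- **Every `f^{(n+1)}`-torsion point of `ℂ_F` is algebraic**: it lies in (the image of) the
Lubin–Tate field `K_π^{n+1}`, which already contains all `q^{n+1}` roots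
(`card_roots_ltPolyIter`). [cite: CasselsFrohlichANT1967, Ch. VI §3.6 Prop. 6 (a)] -/
theorem exists_algClosureToC_eq_of_aeval_eq_zero (n : ℕ) {μ : CompletedAlgClosure F}
    (hμ : Polynomial.aeval μ ((ltPolyIter F π (n + 1)).map (algebraMap 𝒪[F] F)) = 0) :
    ∃ y : ltField π n, algClosureToC F (y : AlgebraicClosure F) = μ := by
  classical
  obtain ⟨hcard, -, -⟩ := card_roots_ltPolyIter hπ n
  set P := ((ltPolyIter F π (n + 1)).map (algebraMap 𝒪[F] F)).map (algebraMap F (ltField π n)) with hP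
  have hmon : P.Monic := ((monic_ltPolyIter π (n + 1)).1.map _).map _
  have hdeg : P.natDegree = residueFieldCard F ^ (n + 1) := by
    rw [hP, ((monic_ltPolyIter π (n + 1)).1.map _).natDegree_map,
      (monic_ltPolyIter π (n + 1)).1.natDegree_map, (monic_ltPolyIter π (n + 1)).2]
  set g : ltField π n →+* CompletedAlgClosure F :=
    (algClosureToC F).comp (algebraMap (ltField π n) (AlgebraicClosure F)) with hg
  have hroots := hmon.roots_map_of_card_eq_natDegree g (hcard.trans hdeg.symm)
  have hPg : P.map g = ((ltPolyIter F π (n + 1)).map (algebraMap 𝒪[F] F)).map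
      (algebraMap F (CompletedAlgClosure F)) := by
    rw [hP, Polynomial.map_map]
    congr 1
  have hμroot : μ ∈ (P.map g).roots := by
    rw [Polynomial.mem_roots (Polynomial.map_monic_ne_zero hmon), Polynomial.IsRoot.def, hPg,
      Polynomial.eval_map, ← Polynomial.aeval_def]
    exact hμ
  rw [← hroots, Multiset.mem_map] at hμroot
  obtain ⟨y, -, hy⟩ := hμroot
  exact ⟨y, hy⟩

/-- `unrGal` is multiplicative. [folklore] -/
theorem unrGal_mul (σ τ : absoluteGaloisGroup F) : unrGal (σ * τ) = (unrGal σ).comp (unrGal τ) := by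
  ext c
  simp only [unrGal, map_mul, RingHom.comp_apply, RingEquiv.toRingHom_eq_coe, RingHom.coe_coe]
  rfl

/-- `unrGal 1 = id`. [folklore] -/
theorem unrGal_one : unrGal (1 : absoluteGaloisGroup F) = RingHom.id (UnrCoeff F) := by
  ext c
  simp only [unrGal, map_one, RingHom.comp_apply, RingEquiv.toRingHom_eq_coe, RingHom.coe_coe,
    RingHom.id_apply]
  exact (UnrCoeff.of F).apply_symm_apply c

/-- `unrGal` fixes `𝒪_F`. [folklore] -/
theorem unrGal_intToUnrCoeff (τ : absoluteGaloisGroup F) (a : 𝒪[F]) :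
    unrGal τ (intToUnrCoeff F a) = intToUnrCoeff F a := by
  change UnrCoeff.of F (maxUnramifiedCompletion.galAut F τ
    ((UnrCoeff.of F).symm (UnrCoeff.of F (algebraMap 𝒪[F] (maxUnramifiedCompletion F) a)))) =
    UnrCoeff.of F (algebraMap 𝒪[F] (maxUnramifiedCompletion F) a)
  rw [RingEquiv.symm_apply_apply, maxUnramifiedCompletion.galAut_algebraMap]

omit [IsNonarchimedeanLocalField F] [TopologicalSpace F] [ValuativeRel F] [Field F] in
/-- `map` commutes with one-variable substitution (change of rings). [folklore] -/
theorem map_subst₁ {R S : Type*} [CommRing R] [CommRing S] (h : R →+* S) {a : PowerSeries R}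
    (ha : PowerSeries.constantCoeff a = 0) (g : PowerSeries R) :
    PowerSeries.map h (PowerSeries.subst a g) =
      PowerSeries.subst (PowerSeries.map h a) (PowerSeries.map h g) :=
  PowerSeries.map_subst (PowerSeries.HasSubst.of_constantCoeff_zero' ha) g

/-- `[a]_f` is fixed coefficientwise by `Γ_F`. [folklore] -/
theorem map_unrGal_homC (τ : absoluteGaloisGroup F) (a : 𝒪[F]) :
    PowerSeries.map (unrGal τ) (homC hπ a) = homC hπ a := by
  rw [homC, ← RingHom.comp_apply (PowerSeries.map (unrGal τ)), ← PowerSeries.map_comp,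
    show (unrGal τ).comp (intToUnrCoeff F) = intToUnrCoeff F from RingHom.ext (unrGal_intToUnrCoeff τ)]

/-- `ϑ^φ = ϑ ∘ [u]_f` over the discrete copy. [cite: LubinTate1965, Lemma p. 385, (16)] -/
theorem map_unrGal_compSeriesC :
    PowerSeries.map (unrGal σ₀) (compSeriesC hπ hσ₀ u hε) =
      PowerSeries.subst (homC hπ (u : 𝒪[F])) (compSeriesC hπ hσ₀ u hε) := by
  have hcomm : (unrGal σ₀).comp (UnrCoeff.of F).toRingHom =
      (UnrCoeff.of F).toRingHom.comp (maxUnramifiedCompletion.galAut F σ₀).toRingHom := by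
    ext c
    change UnrCoeff.of F (maxUnramifiedCompletion.galAut F σ₀ ((UnrCoeff.of F).symm (UnrCoeff.of F c))) =
      UnrCoeff.of F (maxUnramifiedCompletion.galAut F σ₀ c)
    rw [RingEquiv.symm_apply_apply]
  rw [compSeriesC, ← RingHom.comp_apply (PowerSeries.map (unrGal σ₀)), ← PowerSeries.map_comp, hcomm,
    PowerSeries.map_comp, RingHom.comp_apply, map_ltComparison, map_subst₁ _ (constantCoeff_map_hom _ _ _ _),
    homC, intToUnrCoeff, PowerSeries.map_comp, RingHom.comp_apply]

/-- **`ϑ = ϑ^{φ⁻¹} ∘ [u]_f`** (apply `φ⁻¹` to (16); `[u]_f` has coefficients in `𝒪_F`).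
[cite: LubinTate1965, Lemma p. 385, (16)] -/
theorem subst_homC_map_unrGal_inv_compSeriesC :
    PowerSeries.subst (homC hπ (u : 𝒪[F])) (PowerSeries.map (unrGal σ₀⁻¹) (compSeriesC hπ hσ₀ u hε)) =
      compSeriesC hπ hσ₀ u hε :=
  calc PowerSeries.subst (homC hπ (u : 𝒪[F])) (PowerSeries.map (unrGal σ₀⁻¹) (compSeriesC hπ hσ₀ u hε))
      = PowerSeries.map (unrGal σ₀⁻¹) (PowerSeries.subst (homC hπ (u : 𝒪[F])) (compSeriesC hπ hσ₀ u hε)) := by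
        rw [map_subst₁ _ (constantCoeff_homC hπ _), map_unrGal_homC]
    _ = PowerSeries.map (unrGal σ₀⁻¹) (PowerSeries.map (unrGal σ₀) (compSeriesC hπ hσ₀ u hε)) := by
        rw [map_unrGal_compSeriesC]
    _ = compSeriesC hπ hσ₀ u hε := by
        rw [← RingHom.comp_apply (PowerSeries.map (unrGal σ₀⁻¹)), ← PowerSeries.map_comp, ← unrGal_mul,
          inv_mul_cancel, unrGal_one, PowerSeries.map_id]
        rfl

/-- Evaluation form: `ϑ^{φ⁻¹}([u]_f z) = ϑ(z)` on `𝔪_ℂ`. [cite: LubinTate1965, Lemma p. 385, (16)] -/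
theorem evalPt₁_map_unrGal_inv_compSeriesC (z : (maxNilIdealC F).toIdeal) :
    evalPt₁ (maxNilIdealC F) (PowerSeries.map (unrGal σ₀⁻¹) (compSeriesC hπ hσ₀ u hε)) (by
        rw [← PowerSeries.coeff_zero_eq_constantCoeff_apply, PowerSeries.coeff_map,
          PowerSeries.coeff_zero_eq_constantCoeff_apply, constantCoeff_compSeriesC, map_zero])
        (evalPt₁ (maxNilIdealC F) (homC hπ (u : 𝒪[F])) (constantCoeff_homC hπ _) z) =
      evalPt₁ (maxNilIdealC F) (compSeriesC hπ hσ₀ u hε) (constantCoeff_compSeriesC hπ hσ₀ u hε) z := by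
  have hser := subst_homC_map_unrGal_inv_compSeriesC hπ hσ₀ u hε
  have hc0 : PowerSeries.constantCoeff (PowerSeries.map (unrGal σ₀⁻¹) (compSeriesC hπ hσ₀ u hε)) = 0 := by
    rw [← PowerSeries.coeff_zero_eq_constantCoeff_apply, PowerSeries.coeff_map,
      PowerSeries.coeff_zero_eq_constantCoeff_apply, constantCoeff_compSeriesC, map_zero]
  have hc : (PowerSeries.subst (homC hπ (u : 𝒪[F]))
      (PowerSeries.map (unrGal σ₀⁻¹) (compSeriesC hπ hσ₀ u hε))).constantCoeff = 0 := by
    rw [hser]; exact constantCoeff_compSeriesC hπ hσ₀ u hε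
  have h1 := evalPt₁_subst (maxNilIdealC F) (τ := Unit) (homC hπ (u : 𝒪[F]) : MvPowerSeries Unit (UnrCoeff F))
    (constantCoeff_homC hπ _) _ hc0 hc (fun _ => z)
  rw [evalPt_congr (maxNilIdealC F) hser hc (constantCoeff_compSeriesC hπ hσ₀ u hε)] at h1
  exact h1.symm

end ComparisonPoints

end Points

end Literature.NumberTheory.GaloisRepresentations

end
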